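import Summits.Ventures.PercRepro.PurePairGraphDefs
import Summits.Ventures.PercRepro.StarGadgetGraphReachCount

/-!
# The pure-pair gadget — counting the configurations of a cell (module 5)

The cell machinery of `StarGadgetGraphReachCount` (`dmat`, `wcond`, `Wfun`, the certificate lemma)
is reused; the BRANCH-typed bookkeeping is new: branch configurations, the allowed ones (`allowed`),
the fact families over the branches (`famPred`, `factOf`), the product count with FIVE bases
(`card_allowed_not_facts`) and the cell theorem `cell_eq`; the detour facts are symmetric
(`PD_comm`, `bDpred_comm`).
-/

namespace PercRepro.PurePairGraph

open Finset StarGadgetGraph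

variable {p q r s n : ℕ}

/-- The branch configurations: the states of all branch edges. -/
abbrev BrConfig (p q r s n : ℕ) := (Σ b : Br p q r s n, BrEdge' (brType b)) → Bool

/-- The branch configurations are finite. -/
instance : Fintype (BrConfig p q r s n) := Pi.instFintype

/-- The branch configurations have decidable equality. -/
instance : DecidableEq (BrConfig p q r s n) := inferInstance

/-- A configuration of the gadget from the state `g` of the edge `c – x` and a branch
configuration. -/
def mk (g : Fin 1 → Bool) (σ : BrConfig p q r s n) : Config (PE p q r s n) := Sum.elim g σ

/-- The hub states of `mk g σ` are fibre states of `σ`. -/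
theorem hubState_mk (g : Fin 1 → Bool) (σ : BrConfig p q r s n) (h : Hub p q r s) :
    hubState (mk g σ) h = fibreState σ (Sum.inl h) := rfl

/-- The pair states of `mk g σ` are fibre states of `σ`. -/
theorem pairState_mk (g : Fin 1 → Bool) (σ : BrConfig p q r s n) (j : Fin n) :
    pairState (mk g σ) j = fibreState σ (Sum.inr j) := rfl

/-- The state of any branch of `mk g σ` is its fibre state. -/
theorem brState_mk (g : Fin 1 → Bool) (σ : BrConfig p q r s n) (b : Br p q r s n) :
    (fun e => (mk g σ) (.inr ⟨b, e⟩)) = fibreState σ b := rfl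

/-- `cxOpen` of `mk g σ` is the bit `cxbit g` (of `StarGadgetGraphReachCount`). -/
theorem cxOpen_mk_iff (g : Fin 1 → Bool) (σ : BrConfig p q r s n) :
    cxOpen (mk g σ) ↔ cxbit g = true := by
  unfold cxOpen cxbit mk
  simp [Fin.exists_fin_one]

/-- A predicate on branch states (of every type). -/
abbrev BrStatePred := ∀ τ : BrType, (BrEdge' τ → Bool) → Prop

/-- All branches of `σ` are in states allowed in mode `μ`. -/
def allowed (μ : Mode) (σ : BrConfig p q r s n) : Prop :=
  ∀ b, bInA μ (brType b) (fibreState σ b)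

/-- `allowed` is decidable. -/
instance (μ : Mode) (σ : BrConfig p q r s n) : Decidable (allowed μ σ) := by
  unfold allowed; infer_instance

/-- The fact family of a cell: the detour fact of the pair, or the witness, by branch type. -/
def famPred {k : ℕ} (μ : Mode) (X : Option (Fin 3)) (pairs : Fin k → Option (Fin 4 × Fin 4))
    (l : Fin k) (τ : BrType) (s : BrEdge' τ → Bool) : Prop :=
  match pairs l with
  | some ij => bDpred μ X ij.1 ij.2 τ s
  | none => bWpred μ τ s

/-- `famPred` is decidable. -/
instance {k : ℕ} (μ : Mode) (X : Option (Fin 3)) (pairs : Fin k → Option (Fin 4 × Fin 4))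
    (l : Fin k) (τ : BrType) (s : BrEdge' τ → Bool) : Decidable (famPred μ X pairs l τ s) := by
  unfold famPred
  split <;> infer_instance

/-- An existential fact about the branches: some branch is in a state satisfying `Q`. -/
def factOf (Q : BrStatePred) (σ : BrConfig p q r s n) : Prop := ∃ b, Q (brType b) (fibreState σ b)

/-- `factOf` is decidable for decidable `Q`. -/
instance (Q : BrStatePred) [∀ τ s, Decidable (Q τ s)] (σ : BrConfig p q r s n) :
    Decidable (factOf Q σ) := by
  unfold factOf; infer_instance

/-- The fact vector of a branch configuration. -/
def tvec {k : ℕ} (μ : Mode) (X : Option (Fin 3)) (pairs : Fin k → Option (Fin 4 × Fin 4))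
    (σ : BrConfig p q r s n) : Fin k → Bool :=
  fun l => decide (factOf (famPred μ X pairs l) σ)

/-- The number of allowed states of the branch type `τ` avoiding the facts of `U`. -/
def cT {k : ℕ} (μ : Mode) (X : Option (Fin 3)) (pairs : Fin k → Option (Fin 4 × Fin 4))
    (U : Finset (Fin k)) (τ : BrType) : ℕ :=
  (univ.filter fun s : BrEdge' τ → Bool => bInA μ τ s ∧ ∀ l ∈ U, ¬ famPred μ X pairs l τ s).card

/-- **The product count** with five bases: the four hub types and the pair. -/
theorem card_allowed_not_facts {k : ℕ} (μ : Mode) (X : Option (Fin 3))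
    (pairs : Fin k → Option (Fin 4 × Fin 4)) (U : Finset (Fin k)) :
    (univ.filter fun σ : BrConfig p q r s n =>
      allowed μ σ ∧ ∀ l ∈ U, ¬ factOf (famPred μ X pairs l) σ).card =
      cT μ X pairs U (.inl .ab) ^ p * cT μ X pairs U (.inl .ac) ^ q *
        cT μ X pairs U (.inl .bc) ^ r * cT μ X pairs U (.inl .abc) ^ s *
        cT μ X pairs U (.inr ()) ^ n := by
  have h1 : (univ.filter fun σ : BrConfig p q r s n =>
      allowed μ σ ∧ ∀ l ∈ U, ¬ factOf (famPred μ X pairs l) σ) =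
      univ.filter fun σ : BrConfig p q r s n => ∀ b, fibreState σ b ∈
        (univ.filter fun s' : BrEdge' (brType b) → Bool =>
          bInA μ (brType b) s' ∧ ∀ l ∈ U, ¬ famPred μ X pairs l (brType b) s') := by
    ext σ
    simp only [mem_filter, mem_univ, true_and, allowed, factOf, not_exists]
    constructor
    · rintro ⟨hA, hF⟩ b
      exact ⟨hA b, fun l hl => hF l hl b⟩
    · intro H
      exact ⟨fun b => (H b).1, fun l hl b => (H b).2 l hl⟩
  rw [h1, PercRepro.card_filter_fibres_eq_prod]
  have h2 : (fun b : Br p q r s n => (univ.filter fun s' : BrEdge' (brType b) → Bool =>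
      bInA μ (brType b) s' ∧ ∀ l ∈ U, ¬ famPred μ X pairs l (brType b) s').card) =
      Sum.elim (Sum.elim (fun _ => cT μ X pairs U (.inl .ab)) (Sum.elim (fun _ => cT μ X pairs U (.inl .ac))
        (Sum.elim (fun _ => cT μ X pairs U (.inl .bc)) (fun _ => cT μ X pairs U (.inl .abc)))))
        (fun _ => cT μ X pairs U (.inr ())) := by
    funext b
    rcases b with (_ | _ | _ | _) | _ <;> rfl
  rw [h2, Fintype.prod_sum_type]
  simp only [Sum.elim_inl, Sum.elim_inr]
  rw [prod_sum_elim_const_four]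
  simp only [prod_const, card_univ, Fintype.card_fin]

/-- **The cell theorem** (five bases). -/
theorem cell_eq {k : ℕ} (β : Bool) (μ : Mode) (X : Option (Fin 3))
    (pairs : Fin k → Option (Fin 4 × Fin 4)) (src dst : Fin 4)
    (L : List (ℤ × Finset (Fin k) × ℕ × ℕ × ℕ × ℕ × ℕ))
    (hcert : ∀ t : Fin k → Bool,
      (L.map fun e => if e.2.1 ⊆ zeros t then e.1 else 0).sum = Wfun true β μ X pairs src dst t)
    (hbase : ∀ e ∈ L, cT μ X pairs e.2.1 (.inl .ab) = e.2.2.1 ∧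
      cT μ X pairs e.2.1 (.inl .ac) = e.2.2.2.1 ∧ cT μ X pairs e.2.1 (.inl .bc) = e.2.2.2.2.1 ∧
      cT μ X pairs e.2.1 (.inl .abc) = e.2.2.2.2.2.1 ∧ cT μ X pairs e.2.1 (.inr ()) = e.2.2.2.2.2.2) :
    ∑ σ ∈ univ.filter (allowed μ : BrConfig p q r s n → Prop),
        Wfun true β μ X pairs src dst (tvec μ X pairs σ) =
      (L.map fun e => e.1 * ((e.2.2.1 : ℤ) ^ p * (e.2.2.2.1 : ℤ) ^ q * (e.2.2.2.2.1 : ℤ) ^ r *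
        (e.2.2.2.2.2.1 : ℤ) ^ s * (e.2.2.2.2.2.2 : ℤ) ^ n)).sum := by
  have h := sum_weight_eq_of_cert (allowed μ : BrConfig p q r s n → Prop)
    (fun l σ => factOf (famPred μ X pairs l) σ) (Wfun true β μ X pairs src dst)
    (L.map fun e => (e.1, e.2.1)) (by
      intro t
      rw [← hcert t, List.map_map]
      rfl)
  rw [show (fun σ : BrConfig p q r s n => Wfun true β μ X pairs src dst (tvec μ X pairs σ)) =
      fun σ => Wfun true β μ X pairs src dst (fun l => decide (factOf (famPred μ X pairs l) σ))
    from rfl]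
  rw [h, List.map_map]
  congr 1
  refine List.map_congr_left fun e he => ?_
  simp only [Function.comp]
  rw [PurePairGraph.card_allowed_not_facts]
  obtain ⟨h1, h2, h3, h4, h5⟩ := hbase e he
  rw [h1, h2, h3, h4, h5]
  push_cast
  rfl

/-- The pair detour fact is symmetric in the two centrals. -/
theorem PD_comm (μ : Mode) (X : Option (Fin 3)) (i j : Fin 4) (s : Fin 5 → Bool) :
    PD μ X i j s ↔ PD μ X j i s := by
  constructor <;>
  · rintro ⟨w, hX, h1, h2 | ⟨hX', hin, h2⟩⟩
    · exact ⟨w, hX, h2, Or.inl h1⟩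
    · refine ⟨!w, hX', h2, Or.inr ⟨?_, hin, ?_⟩⟩ <;> simp only [Bool.not_not] <;> assumption

/-- The branch detour fact is symmetric in the two centrals. -/
theorem bDpred_comm (μ : Mode) (X : Option (Fin 3)) (i j : Fin 4) (τ : BrType)
    (s : BrEdge' τ → Bool) : bDpred μ X i j τ s ↔ bDpred μ X j i τ s := by
  cases τ
  · show (¬ inX μ X _ s ∧ Hf μ i _ s ∧ Hf μ j _ s) ↔ (¬ inX μ X _ s ∧ Hf μ j _ s ∧ Hf μ i _ s)
    constructor <;> rintro ⟨h1, h2, h3⟩ <;> exact ⟨h1, h3, h2⟩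
  · exact PD_comm μ X i j s

end PercRepro.PurePairGraph
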